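import Summits.BirchSwinnertonDyer.Rank1Residual.JET.CarrierReadingRecordsKit
import HarnessLib

/-!
# BSD rank-≤1 residual cell, lane class X11b (`3 ∥ N`: MULTIPLICATIVE at `3`, `ρ̄_{E,3}` onto), rank ONE, Tamagawa-OBSTRUCTED with ONE carrier
# prime: `BSD(E,3)` PER CELL through the JET lane's R-IDX kit doors `JET.bsdp_of_jetRowA3_tam_min` / `_tamX_min` (carrier `q ≠ 3`, READING
# binder K1) and `JET.bsdp_of_jetRowB3_tam_min` (carrier `3`, READING binder K3) on a two-engine HEEGNER-INDEX line in a DEEP field — records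
# 04 (x11c GEN 36 «J1-REMAINDER / KOLY-R»)

HONEST FRAMING (cell `b2b-bsdres-*`, verbatim): prove what is provable now; shrink each hard class to its core with data; no claim beyond
stated classes; COMBINATION classes deleted from PUBLISHED theorems only, CONSTRUCTION-shaped remainder typed; this is not "finishing BSD".
X4 / X11b (and X11 ∧ r = 1 ∧ p = 3) stay CONSTRUCTION-SHAPED; everything here is PER CELL; no lane verdict is changed; NO named fact is
introduced (debt 0) and NO definition; nothing is booked by this file (bookings are referee A's, pub-bsdpct); Cremona's numbers (`r_an`,
`#Ш_an`, models, generators, `∏ c_ℓ`, torsion, optimality / Manin codes, the galrep datum) and the Kurihara lane's per-prime tables are INPUTS.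

Unit `b2b-bsdres-x11c`, GEN 36 (prover-b2b-bsdres-x11c-g36-0), move «J1-REMAINDER / KOLY-R». POPULATION (`HOME/b2b-bsdres-x11c/gen36/pop/`:
`census36.py` over referee A's ROUND 983 state of record × the Kurihara lane's sweep records × Cremona, then `build_pop36.py`): EVERY live
residue cell on the Kolyvagin / Jetchev road classes (X4, X7, X8, X11a, X11b), BOTH ranks, odd `p`, whose shape is KOLY (`ρ̄_{E,p}` onto,
`p ∤ #E(ℚ)_tors·∏c·#Ш_an`: 30 cells) or J1 (onto, `p ∤ #E(ℚ)_tors·#Ш_an`, exactly ONE prime `q ∣ N` with `p ∣ c_q`: 171 cells; the two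
J1 cells whose carrier is an ADDITIVE `p` have no door and are excluded) — 199 cells on 191 classes (188 of them with this cell as their ONLY
open cell): 82 rank-one `(3, X11b)`, 59 `(5, X4)` + 2 `(7, X4)` (rank one 19 / rank zero 42), 26 `(3, X4)` J1 (1 / 25), 20 `(3, X4)` KOLY
(6 / 14), 10 KOLY at `p ≥ 5`. The lane never certified them: at rank one its Heegner fields (`|D| ≤ 1511`) read `ord_p [E(K):ℤy_K] = w + 1`
or found no admissible field; at rank zero (additive `p`) no Heegner-index line was ever run. THIS UNIT ran the cell's engines VERBATIM in
DEEPER fields: engine 1 = gen 3 `engine1_cha1b/main.py` = x9-g7 `jobD1b.py` (cypari2, sha256 `69e29ec7…`; rank-one mode: Cremona's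
generator, `hy = L'(E,1)·L(E^D,1)·√|D|/(4·Area)`, `m = √(4·hy/ĥ(P))`; rank-zero mode: the rank-one twist `F = E^D`, a point `x ∈ F(ℚ)` by
`ellrank`, saturated, `hy = L(E,1)·L'(F,1)·√|D|/(4·Area)`, `m = √(4·hy/ĥ(x))` — Miller 2011 Thm. 4.1 / Cor. 4.8; `NDISC 16`, `DBOUND 6000`);
engine 2 = gen 3 `run_cert.py` (`1b54bb20…`) + `e2lib.py` + `tate_stdlib.py` (stdlib re-implementation: `m`, `ord_p m` must be EQUAL,
discrete checks); twist values = additive-p1 `twistvals/main.py` (`e501b988…`). Kit jobs: see HOME/b2b-bsdres-x11c/gen36/harvest/JOBS-gen36.txt. Evidence `HOME/b2b-bsdres-x11c/gen36/`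
(POP36.md, ROWS36-TABLE.md, harvest outputs with inputs.sha256, SHA256SUMS); REPORT.md §45.

THE ROAD (cell `bsd-jet`'s R-IDX grammar, the doors referee A priced at pub-bsdpct ROUNDS 409 / 516 / 600 and booked this unit's
JDEEP rows on at ROUND 890): Jetchev 2008 Thm. 1.4 / Cor. 1.5 READ at the ONE Tamagawa carrier — READING binder K1
`JET.JetchevDivisibilityCarrierNe` (p459625; carrier `q ≠ p`) or K3 `JET.JetchevDivisibilityCarrierMult` (p463660; carrier `q = p` split
multiplicative), both `@[conjecture]` typed readings CONSUMED AS HYPOTHESES (nothing about K1 / K3 is asserted here) — + McCallum 1991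
Cor. 5.6 (`hMcU`), GZK (`hGZK`), Kolyvagin / Gross–Zagier bookkeeping (`hKo`, `hrec`, `hD36`, `hlev`): with `w = ord_p c_q` at the carrier
and a Heegner field `K` in which `ord_p [E(K):ℤy_K] ≤ w`, `Ш(E/ℚ)[p] = 0`, and with `ord_p #Ш_an = 0`, Miller's `BSD(E,p)`.
IN THE KERNEL per cell (`decide` / `norm_num` goals of ONE kit application): the literal Cremona model (`Δ ≠ 0`; global minimality by the
factored Kraus criterion `Supersingular.isGloballyMinimal_of_krausCriterion₃_factored` on the COMPLETE factorisation of `|Δ|`); `ρ̄_{E,p}`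
ONTO (Serre 1972: three Prop-19 witnesses at `p ≥ 5` / an irreducible Frobenius + a Frobenius of order `3` at `p = 3`; the `p`-adic tower
inside the door: Serre IV-23 at `p ≥ 5`, the Tate line at a multiplicative `3`, ONE Frobenius witness mod `9` otherwise); at a
multiplicative `3`: `3 ∣ Δ`, `3 ∤ c₄`; the carrier's Tamagawa number from ONE `TamLocal` (split `I_n`) or exact `TamX` (`IV` / `IV*`)
certificate (n1011-p03's bridges `Additive.IntModelTam.localTamagawaNumber_padic_eq_of_intModel_of_tamLocal` / `_of_tamX`) and
`w ≤ ord_p c_q`. DISPLAYED (hypotheses of every record): `hJ` (READING), `hMcU`, `hGZK`, `hKo`, `hrec`, `hD36`, `hlev`; the Heegner datum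
(`K` imaginary quadratic, `d_K ∉ {−3, −4}`, Heegner hypothesis for the level `N`, `P` a Heegner point of infinite order), bucket A: `q ∣ N`;
the INDEX LINE `hv : ord_p [E(K):ℤP] ≤ w` — THIS UNIT's two-engine deep-field datum, quoted per docstring, NOT re-computed here —;
`hr : r_an ≤ 1`; `hs` / `hvs` : `#Ш_an` a `p`-adic unit (Cremona; exact at rank 0).
What a record is worth is the referee's call (EVIDENCE-grade certificate under displayed binders, as every Heegner-index record of the
cell). Cells in this file: `322140b1`@3, `322140t1`@3, `330990q1`@3, `333060g1`@3, `335244h1`@3, `335580n1`@3, `338910y1`@3.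

References: D. Jetchev, Compos. Math. 144 (2008) Thm. 1.4, Cor. 1.5 [Jetchev2008]; W. McCallum, LMS LN 153 (1991) §1, Cor. 5.6
[McCallumLMS1991]; B. H. Gross, LMS LN 153 (1991) Prop. 2.1 [GrossLMS1991]; V. A. Kolyvagin (1990) [KolyvaginEulerSystems1990];
J.-P. Serre, Invent. Math. 15 (1972) §2.4 Prop. 15, §2.8 Prop. 19 [Serre1972]; J.-P. Serre, *Abelian ℓ-adic representations* IV-23
[SerreAbelianLadic1968]; B. H. Gross, D. Zagier, Invent. Math. 84 (1986) [GrossZagier1986]; R. L. Miller, LMS J. Comput. Math. 14 (2011)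
Thm. 4.1, Cor. 4.8, Def. 1.1 [Miller2011LMS]; C. Wuthrich, Doc. Math. 19 (2014) Lemma 20 [Wuthrich2014]; J. H. Silverman, *AEC* (2009)
VII.1, VII.5 [SilvermanAEC2009], *ATAEC* (1994) IV.9.4 [SilvermanATAEC1994]; A. Kraus, Acta Arith. 54 (1989) [Kraus1989]; Cremona's
tables [Cremona2006].
-/

set_option autoImplicit false

noncomputable section

open scoped Classical

open WeierstrassCurve Literature.NumberTheory.EllipticCurves
  Literature.NumberTheory.EllipticCurves.ModularForms
  Literature.NumberTheory.EllipticCurves.Rank1Residual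
  Literature.NumberTheory.EllipticCurves.Rank1Residual.Typed
  Literature.NumberTheory.EllipticCurves.Rank1Residual.X11RankOneCertificates
  Summit.BirchSwinnertonDyer.BirchSwinnertonDyer.Rank1Residual
  Summit.BirchSwinnertonDyer.BirchSwinnertonDyer.Rank1Residual.IntModel
  Summit.BirchSwinnertonDyer.BirchSwinnertonDyer.Rank1Residual.X11RankOne
  Summit.BirchSwinnertonDyer.BirchSwinnertonDyer.Rank2Observatory.Tam
  Summit.BirchSwinnertonDyer.Rank1Residual.JET

namespace Summit.BirchSwinnertonDyer.Rank1Residual.X11b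

/-- **`BSD(E,3)` for `322140b1`** (cell `(322140b1, 3)`, class X11b, rank 1; JET grammar key `JETA:322140b1@3`, bucket A at `p = 3 ∥ N` (door
`JET.bsdp_of_jetRowA3_tamX_min`)); `N = 322140 = 2^2·3·5·7·13·59`, nonsplit `I4` at `3`, `r_an = 1`, `#E(ℚ)_tors = 1`, `∏c = 12`, `#Ш_an = 1`,
Cremona galrep: no code at this prime (`ρ̄_{E,3}` onto); `|Δ| = ∏` over `[(2, 8), (3, 4), (5, 5), (7, 1), (13, 4), (59, 1)]` (factored Kraus
criterion, every disjunct decided). The ONE carrier: carrier `q = 2` ADDITIVE of type `IV*` (`c_q = 3`, `w = ord_3 c_q = 1`; IN THE KERNEL by the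
exact `TamX` certificate `⟨2, 1, 3, 2, 1, 2, 8, 0⟩`); READING binder `hJ` = K1 `JetchevDivisibilityCarrierNe`; displayed index line `hv : ord_3
[E(K):ℤP] ≤ 1`. Serre Prop-15 witnesses mod `3`: `(ℓ, #Ẽ(𝔽_ℓ))` = `(29, 23)` (`X² − aX + ℓ` root-free over `𝔽₃`), `(61, 51)` (`ℓ ≡ 1`, `a ≡ 2 (mod
3)`, `9 ∤ #Ẽ`). Kurihara lane note of record: «multiplicative p, r=1, irr (Castella 2018 Thm A withdrawn for p||N)». State of record (referee A
ROUND 983, `scratchA_A_state_after_x4gh_add3_onA2R977_fold.pkl`): class `residue`, 1 open cell(s), register empty. Other engine-1 fields tried (`D`: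
`m` (`ord_3 m`)): `-719`: `m = 72` (`ord = 2`); `-4079`: `m = 72` (`ord = 2`); `-4679`: `m = 72` (`ord = 2`); `-4871`: `m = 72` (`ord = 2`);
`-5711`: `m = 24` (`ord = 1`); `-5879`: `m = 24` (`ord = 1`). THIS UNIT'S DATUM (displayed, NOT re-computed here): DEEP FIELD `K = ℚ(√-2831)`
(`2831` = 19·149): **`m = [E(K):ℤy_K] = 24`, `ord_3 m = 1`** (`ρ = m²/4`, `L'(E,1) = 5.0810796368`, `L(E^D,1) = 0.2079359197`, `ĥ(P) =
2.1767788780`; Cremona's generator) — engine 1 j293228 = engine 2 j293889: `m = 24` EQUAL (AGREE v_p(m)=1, dev ≤ 2.0e-13); twist `E^D` (j293892): `N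
= 2581810680540`, `#tors·∏c·#Ш_an = 1·24·1`, `ord_3 #Ш_an(E^D) = 0`, `ord_3 ∏c(E^D) = 1` (BSD-consistent). CONDITIONAL on every binder; per cell;
nothing booked by this file.
[cite: Jetchev2008, Thm. 1.4 and Cor. 1.5 (p. 812)] [cite: McCallumLMS1991, Cor. 5.6] [cite: Serre1972, §2.4 Prop. 15, §2.8 Prop. 19] [cite: Cremona2006, Table 1 (label 322140b1)] -/
theorem bsdpJD_322140b1_3
    (hJ : JetchevDivisibilityCarrierNe)
    (hMcU : McCallum1991_padicValNat_card_sha_primary_add_le_of_globalDivisibility)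
    (hGZK : rank_eq_analyticRank_of_analyticRank_le_one)
    (hKo : ∀ (N : ℕ) [NeZero N] (W : WeierstrassCurve ℚ) (K : Type) [Field K] [NumberField K], kolyvagin N W K)
    (hrec : ∀ (N : ℕ) [NeZero N] (W : WeierstrassCurve ℚ) (K : Type) [Field K] [NumberField K],
      heegnerPointOfConductor_one_galoisConj N W K)
    (hD36 : ∀ (N : ℕ) [NeZero N] (W : WeierstrassCurve ℚ) (K : Type) [Field K] [NumberField K],
      phi_heegnerTau_mem_singularModuliField N W K)
    (hlev : ∀ {N : ℕ} [NeZero N], IsNewformOf.level_eq_conductorNorm (N := N))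
    (W : WeierstrassCurve ℚ) (hW : W = ⟨0, -1, 0, -19516, -1687784⟩)
    {N : ℕ} [NeZero N] {K : Type} [Field K] [NumberField K] (hK : IsImaginaryQuadratic K)
    (hD3 : NumberField.discr K ≠ -3) (hD4 : NumberField.discr K ≠ -4)
    (hH : SatisfiesHeegnerHypothesis N K) {P : (W.baseChange K).toAffine.Point}
    (hP : IsHeegnerPoint N W K P) (hnt : ¬ IsOfFinAddOrder P) (hqN : 2 ∣ N)
    (hv : padicValNat 3 (AddSubgroup.zmultiples P).index ≤ 1)
    (hr : W.analyticRank ≤ 1) {s : ℚ} (hs : shaAn W = (s : ℂ)) (hvs : padicValRat 3 s = 0) : BSDp W 3 :=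
  bsdp_of_jetRowA3_tamX_min 0 (-1) 0 (-19516) (-1687784)
    (Supersingular.isGloballyMinimal_of_krausCriterion₃_factored 0 (-1) 0 (-19516) (-1687784) [(2, 8), (3, 4), (5, 5), (7, 1), (13, 4), (59, 1)] (by decide +kernel)
      (by intro t ht; fin_cases ht <;> norm_num) (by decide +kernel))
    (by decide +kernel) (by decide +kernel)
    29 61 (by norm_num) (by norm_num) (by decide) (by decide) (by decide) (by decide) (by decide +kernel) (by decide +kernel)
    (n₁ := 23) (n₂ := 51) (by decide +kernel) (by decide +kernel) (by decide) (by decide) (by decide) (by decide)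
    2 (by norm_num) ⟨2, 1, 3, 2, 1, 2, 8, 0⟩ rfl (by decide +kernel) (w := 1) (by decide +kernel) (by decide)
    hJ hMcU hGZK hKo hrec hD36 hlev W hW hK hD3 hD4 hH hP hnt hqN hv hr hs hvs

/-- **`BSD(E,3)` for `322140t1`** (cell `(322140t1, 3)`, class X11b, rank 1; JET grammar key `JETA:322140t1@3`, bucket A at `p = 3 ∥ N` (door
`JET.bsdp_of_jetRowA3_tamX_min`)); `N = 322140 = 2^2·3·5·7·13·59`, split `I2` at `3`, `r_an = 1`, `#E(ℚ)_tors = 1`, `∏c = 12`, `#Ш_an = 1`, Cremona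
galrep: no code at this prime (`ρ̄_{E,3}` onto); `|Δ| = ∏` over `[(2, 8), (3, 2), (5, 1), (7, 1), (13, 2), (59, 1)]` (factored Kraus criterion,
every disjunct decided). The ONE carrier: carrier `q = 2` ADDITIVE of type `IV*` (`c_q = 3`, `w = ord_3 c_q = 1`; IN THE KERNEL by the exact `TamX`
certificate `⟨2, 1, 3, 0, 1, 2, 8, 0⟩`); READING binder `hJ` = K1 `JetchevDivisibilityCarrierNe`; displayed index line `hv : ord_3 [E(K):ℤP] ≤ 1`.
Serre Prop-15 witnesses mod `3`: `(ℓ, #Ẽ(𝔽_ℓ))` = `(11, 17)` (`X² − aX + ℓ` root-free over `𝔽₃`), `(61, 51)` (`ℓ ≡ 1`, `a ≡ 2 (mod 3)`, `9 ∤ #Ẽ`).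
Kurihara lane note of record: «multiplicative p, r=1, irr (Castella 2018 Thm A withdrawn for p||N)». State of record (referee A ROUND 983,
`scratchA_A_state_after_x4gh_add3_onA2R977_fold.pkl`): class `residue`, 1 open cell(s), register empty. Other engine-1 fields tried (`D`: `m`
(`ord_3 m`)): `-719`: `m = 72` (`ord = 2`); `-2831`: `m = 144` (`ord = 2`); `-4679`: `m = 72` (`ord = 2`); `-4871`: `m = 24` (`ord = 1`); `-5711`:
`m = 72` (`ord = 2`); `-5879`: `m = 24` (`ord = 1`). THIS UNIT'S DATUM (displayed, NOT re-computed here): DEEP FIELD `K = ℚ(√-4079)` (`4079` =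
prime): **`m = [E(K):ℤy_K] = 96`, `ord_3 m = 1`** (`ρ = m²/4`, `L'(E,1) = 9.2862210638`, `L(E^D,1) = 8.8559195342`, `ĥ(P) = 2.9330059569`; Cremona's
generator) — engine 1 j293234 = engine 2 j294330: `m = 96` EQUAL (AGREE v_p(m)=1, dev ≤ 3.7e-14); twist `E^D` (j294332): `N = 5359842955740`,
`#tors·∏c·#Ш_an = 1·24·16`, `ord_3 #Ш_an(E^D) = 0`, `ord_3 ∏c(E^D) = 1` (BSD-consistent). CONDITIONAL on every binder; per cell; nothing booked by
this file.
[cite: Jetchev2008, Thm. 1.4 and Cor. 1.5 (p. 812)] [cite: McCallumLMS1991, Cor. 5.6] [cite: Serre1972, §2.4 Prop. 15, §2.8 Prop. 19] [cite: Cremona2006, Table 1 (label 322140t1)] -/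
theorem bsdpJD_322140t1_3
    (hJ : JetchevDivisibilityCarrierNe)
    (hMcU : McCallum1991_padicValNat_card_sha_primary_add_le_of_globalDivisibility)
    (hGZK : rank_eq_analyticRank_of_analyticRank_le_one)
    (hKo : ∀ (N : ℕ) [NeZero N] (W : WeierstrassCurve ℚ) (K : Type) [Field K] [NumberField K], kolyvagin N W K)
    (hrec : ∀ (N : ℕ) [NeZero N] (W : WeierstrassCurve ℚ) (K : Type) [Field K] [NumberField K],
      heegnerPointOfConductor_one_galoisConj N W K)
    (hD36 : ∀ (N : ℕ) [NeZero N] (W : WeierstrassCurve ℚ) (K : Type) [Field K] [NumberField K],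
      phi_heegnerTau_mem_singularModuliField N W K)
    (hlev : ∀ {N : ℕ} [NeZero N], IsNewformOf.level_eq_conductorNorm (N := N))
    (W : WeierstrassCurve ℚ) (hW : W = ⟨0, 1, 0, -6700, -213340⟩)
    {N : ℕ} [NeZero N] {K : Type} [Field K] [NumberField K] (hK : IsImaginaryQuadratic K)
    (hD3 : NumberField.discr K ≠ -3) (hD4 : NumberField.discr K ≠ -4)
    (hH : SatisfiesHeegnerHypothesis N K) {P : (W.baseChange K).toAffine.Point}
    (hP : IsHeegnerPoint N W K P) (hnt : ¬ IsOfFinAddOrder P) (hqN : 2 ∣ N)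
    (hv : padicValNat 3 (AddSubgroup.zmultiples P).index ≤ 1)
    (hr : W.analyticRank ≤ 1) {s : ℚ} (hs : shaAn W = (s : ℂ)) (hvs : padicValRat 3 s = 0) : BSDp W 3 :=
  bsdp_of_jetRowA3_tamX_min 0 1 0 (-6700) (-213340)
    (Supersingular.isGloballyMinimal_of_krausCriterion₃_factored 0 1 0 (-6700) (-213340) [(2, 8), (3, 2), (5, 1), (7, 1), (13, 2), (59, 1)] (by decide +kernel)
      (by intro t ht; fin_cases ht <;> norm_num) (by decide +kernel))
    (by decide +kernel) (by decide +kernel)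
    11 61 (by norm_num) (by norm_num) (by decide) (by decide) (by decide) (by decide) (by decide +kernel) (by decide +kernel)
    (n₁ := 17) (n₂ := 51) (by decide +kernel) (by decide +kernel) (by decide) (by decide) (by decide) (by decide)
    2 (by norm_num) ⟨2, 1, 3, 0, 1, 2, 8, 0⟩ rfl (by decide +kernel) (w := 1) (by decide +kernel) (by decide)
    hJ hMcU hGZK hKo hrec hD36 hlev W hW hK hD3 hD4 hH hP hnt hqN hv hr hs hvs

/-- **`BSD(E,3)` for `330990q1`** (cell `(330990q1, 3)`, class X11b, rank 1; JET grammar key `JETB:330990q1@3`, bucket B at `p = 3 ∥ N`, carrier `3`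
(door `JET.bsdp_of_jetRowB3_tam_min`)); `N = 330990 = 2·3·5·11·17·59`, split `I3` at `3`, `r_an = 1`, `#E(ℚ)_tors = 1`, `∏c = 12`, `#Ш_an = 1`,
Cremona galrep: no code at this prime (`ρ̄_{E,3}` onto); `|Δ| = ∏` over `[(2, 10), (3, 3), (5, 5), (11, 1), (17, 5), (59, 2)]` (factored Kraus
criterion, every disjunct decided). The ONE carrier: carrier `q = 3` (split `I3`, `c_q = 3`, `w = ord_3 c_q = 1`; IN THE KERNEL by the `TamLocal`
certificate `⟨3, 1, 1, 0, 0, 0, 0, 3, 0, 0, 3⟩`); READING binder `hJ` = K3 `JetchevDivisibilityCarrierMult`; displayed index line `hv : ord_3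
[E(K):ℤP] ≤ 1`. Serre Prop-15 witnesses mod `3`: `(ℓ, #Ẽ(𝔽_ℓ))` = `(29, 26)` (`X² − aX + ℓ` root-free over `𝔽₃`), `(13, 15)` (`ℓ ≡ 1`, `a ≡ 2 (mod
3)`, `9 ∤ #Ẽ`). Kurihara lane note of record: «multiplicative p, r=1, irr (Castella 2018 Thm A withdrawn for p||N)». State of record (referee A
ROUND 983, `scratchA_A_state_after_x4gh_add3_onA2R977_fold.pkl`): class `residue`, 1 open cell(s), register empty. Other engine-1 fields tried (`D`:
`m` (`ord_3 m`)): `-791`: `m = 72` (`ord = 2`); `-1271`: `m = 72` (`ord = 2`); `-3671`: `m = 72` (`ord = 2`); `-3959`: `m = 24` (`ord = 1`);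
`-4439`: `m = 72` (`ord = 2`); `-4751`: `m = 48` (`ord = 1`); `-5711`: `m = 48` (`ord = 1`). THIS UNIT'S DATUM (displayed, NOT re-computed here):
DEEP FIELD `K = ℚ(√-2279)` (`2279` = 43·53): **`m = [E(K):ℤy_K] = 48`, `ord_3 m = 1`** (`ρ = m²/4`, `L'(E,1) = 5.4034457015`, `L(E^D,1) =
0.4933561665`, `ĥ(P) = 6.8136226612`; Cremona's generator) — engine 1 j293239 = engine 2 j294065: `m = 48` EQUAL (AGREE v_p(m)=1, dev ≤ 5.7e-14);
twist `E^D` (j294066): `N = 1719109432590`, `#tors·∏c·#Ш_an = 1·96·1`, `ord_3 #Ш_an(E^D) = 0`, `ord_3 ∏c(E^D) = 1` (BSD-consistent). CONDITIONAL on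
every binder; per cell; nothing booked by this file.
[cite: Jetchev2008, Thm. 1.4 and Cor. 1.5 (p. 812)] [cite: McCallumLMS1991, Cor. 5.6] [cite: Serre1972, §2.4 Prop. 15, §2.8 Prop. 19] [cite: Cremona2006, Table 1 (label 330990q1)] -/
theorem bsdpJD_330990q1_3
    (hJ : JetchevDivisibilityCarrierMult)
    (hMcU : McCallum1991_padicValNat_card_sha_primary_add_le_of_globalDivisibility)
    (hGZK : rank_eq_analyticRank_of_analyticRank_le_one)
    (hKo : ∀ (N : ℕ) [NeZero N] (W : WeierstrassCurve ℚ) (K : Type) [Field K] [NumberField K], kolyvagin N W K)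
    (hrec : ∀ (N : ℕ) [NeZero N] (W : WeierstrassCurve ℚ) (K : Type) [Field K] [NumberField K],
      heegnerPointOfConductor_one_galoisConj N W K)
    (hD36 : ∀ (N : ℕ) [NeZero N] (W : WeierstrassCurve ℚ) (K : Type) [Field K] [NumberField K],
      phi_heegnerTau_mem_singularModuliField N W K)
    (hlev : ∀ {N : ℕ} [NeZero N], IsNewformOf.level_eq_conductorNorm (N := N))
    (W : WeierstrassCurve ℚ) (hW : W = ⟨1, 0, 1, -1698769, -858712924⟩)
    {N : ℕ} [NeZero N] {K : Type} [Field K] [NumberField K] (hK : IsImaginaryQuadratic K)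
    (hD3 : NumberField.discr K ≠ -3) (hD4 : NumberField.discr K ≠ -4)
    (hH : SatisfiesHeegnerHypothesis N K) {P : (W.baseChange K).toAffine.Point}
    (hP : IsHeegnerPoint N W K P) (hnt : ¬ IsOfFinAddOrder P)
    (hv : padicValNat 3 (AddSubgroup.zmultiples P).index ≤ 1)
    (hr : W.analyticRank ≤ 1) {s : ℚ} (hs : shaAn W = (s : ℂ)) (hvs : padicValRat 3 s = 0) : BSDp W 3 :=
  bsdp_of_jetRowB3_tam_min 1 0 1 (-1698769) (-858712924)
    (Supersingular.isGloballyMinimal_of_krausCriterion₃_factored 1 0 1 (-1698769) (-858712924) [(2, 10), (3, 3), (5, 5), (11, 1), (17, 5), (59, 2)] (by decide +kernel)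
      (by intro t ht; fin_cases ht <;> norm_num) (by decide +kernel))
    (by decide +kernel) (by decide +kernel)
    29 13 (by norm_num) (by norm_num) (by decide) (by decide) (by decide) (by decide) (by decide +kernel) (by decide +kernel)
    (n₁ := 26) (n₂ := 15) (by decide +kernel) (by decide +kernel) (by decide) (by decide) (by decide) (by decide)
    ⟨3, 1, 1, 0, 0, 0, 0, 3, 0, 0, 3⟩ rfl (by decide +kernel) (c := 3) (by decide +kernel) (w := 1) (by decide +kernel)
    hJ hMcU hGZK hKo hrec hD36 hlev W hW hK hD3 hD4 hH hP hnt hv hr hs hvs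

/-- **`BSD(E,3)` for `333060g1`** (cell `(333060g1, 3)`, class X11b, rank 1; JET grammar key `JETA:333060g1@3`, bucket A at `p = 3 ∥ N` (door
`JET.bsdp_of_jetRowA3_tamX_min`)); `N = 333060 = 2^2·3·5·7·13·61`, nonsplit `I17` at `3`, `r_an = 1`, `#E(ℚ)_tors = 1`, `∏c = 30`, `#Ш_an = 1`,
Cremona galrep: no code at this prime (`ρ̄_{E,3}` onto); `|Δ| = ∏` over `[(2, 4), (3, 17), (5, 5), (7, 10), (13, 1), (61, 1)]` (factored Kraus
criterion, every disjunct decided). The ONE carrier: carrier `q = 2` ADDITIVE of type `IV` (`c_q = 3`, `w = ord_3 c_q = 1`; IN THE KERNEL by the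
exact `TamX` certificate `⟨2, 1, 1, 0, 1, 1, 4, 0⟩`); READING binder `hJ` = K1 `JetchevDivisibilityCarrierNe`; displayed index line `hv : ord_3
[E(K):ℤP] ≤ 1`. Serre Prop-15 witnesses mod `3`: `(ℓ, #Ẽ(𝔽_ℓ))` = `(11, 10)` (`X² − aX + ℓ` root-free over `𝔽₃`), `(43, 51)` (`ℓ ≡ 1`, `a ≡ 2 (mod
3)`, `9 ∤ #Ẽ`). Kurihara lane note of record: «multiplicative p, r=1, irr (Castella 2018 Thm A withdrawn for p||N)». State of record (referee A
ROUND 983, `scratchA_A_state_after_x4gh_add3_onA2R977_fold.pkl`): class `residue`, 1 open cell(s), register ('JET@p|N', 5). Other engine-1 fields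
tried (`D`: `m` (`ord_3 m`)): `-719`: `m = 180` (`ord = 2`); `-2831`: `m = 180` (`ord = 2`); `-3839`: `m = 360` (`ord = 2`); `-4871`: `m = 180`
(`ord = 2`). THIS UNIT'S DATUM (displayed, NOT re-computed here): DEEP FIELD `K = ℚ(√-1511)` (`1511` = prime): **`m = [E(K):ℤy_K] = 60`, `ord_3 m =
1`** (`ρ = m²/4`, `L'(E,1) = 5.4613351030`, `L(E^D,1) = 0.1235659212`, `ĥ(P) = 5.8676954635`; Cremona's generator) — engine 1 j293228 = engine 2
j293889: `m = 60` EQUAL (AGREE v_p(m)=1, dev ≤ 3.7e-15); twist `E^D` (j293892): `N = 760416280260`, `#tors·∏c·#Ш_an = 1·60·1`, `ord_3 #Ш_an(E^D) =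
0`, `ord_3 ∏c(E^D) = 1` (BSD-consistent). CONDITIONAL on every binder; per cell; nothing booked by this file.
[cite: Jetchev2008, Thm. 1.4 and Cor. 1.5 (p. 812)] [cite: McCallumLMS1991, Cor. 5.6] [cite: Serre1972, §2.4 Prop. 15, §2.8 Prop. 19] [cite: Cremona2006, Table 1 (label 333060g1)] -/
theorem bsdpJD_333060g1_3
    (hJ : JetchevDivisibilityCarrierNe)
    (hMcU : McCallum1991_padicValNat_card_sha_primary_add_le_of_globalDivisibility)
    (hGZK : rank_eq_analyticRank_of_analyticRank_le_one)
    (hKo : ∀ (N : ℕ) [NeZero N] (W : WeierstrassCurve ℚ) (K : Type) [Field K] [NumberField K], kolyvagin N W K)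
    (hrec : ∀ (N : ℕ) [NeZero N] (W : WeierstrassCurve ℚ) (K : Type) [Field K] [NumberField K],
      heegnerPointOfConductor_one_galoisConj N W K)
    (hD36 : ∀ (N : ℕ) [NeZero N] (W : WeierstrassCurve ℚ) (K : Type) [Field K] [NumberField K],
      phi_heegnerTau_mem_singularModuliField N W K)
    (hlev : ∀ {N : ℕ} [NeZero N], IsNewformOf.level_eq_conductorNorm (N := N))
    (W : WeierstrassCurve ℚ) (hW : W = ⟨0, -1, 0, -32515670, -91864779975⟩)
    {N : ℕ} [NeZero N] {K : Type} [Field K] [NumberField K] (hK : IsImaginaryQuadratic K)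
    (hD3 : NumberField.discr K ≠ -3) (hD4 : NumberField.discr K ≠ -4)
    (hH : SatisfiesHeegnerHypothesis N K) {P : (W.baseChange K).toAffine.Point}
    (hP : IsHeegnerPoint N W K P) (hnt : ¬ IsOfFinAddOrder P) (hqN : 2 ∣ N)
    (hv : padicValNat 3 (AddSubgroup.zmultiples P).index ≤ 1)
    (hr : W.analyticRank ≤ 1) {s : ℚ} (hs : shaAn W = (s : ℂ)) (hvs : padicValRat 3 s = 0) : BSDp W 3 :=
  bsdp_of_jetRowA3_tamX_min 0 (-1) 0 (-32515670) (-91864779975)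
    (Supersingular.isGloballyMinimal_of_krausCriterion₃_factored 0 (-1) 0 (-32515670) (-91864779975) [(2, 4), (3, 17), (5, 5), (7, 10), (13, 1), (61, 1)] (by decide +kernel)
      (by intro t ht; fin_cases ht <;> norm_num) (by decide +kernel))
    (by decide +kernel) (by decide +kernel)
    11 43 (by norm_num) (by norm_num) (by decide) (by decide) (by decide) (by decide) (by decide +kernel) (by decide +kernel)
    (n₁ := 10) (n₂ := 51) (by decide +kernel) (by decide +kernel) (by decide) (by decide) (by decide) (by decide)
    2 (by norm_num) ⟨2, 1, 1, 0, 1, 1, 4, 0⟩ rfl (by decide +kernel) (w := 1) (by decide +kernel) (by decide)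
    hJ hMcU hGZK hKo hrec hD36 hlev W hW hK hD3 hD4 hH hP hnt hqN hv hr hs hvs

/-- **`BSD(E,3)` for `335244h1`** (cell `(335244h1, 3)`, class X11b, rank 1; JET grammar key `JETA:335244h1@3`, bucket A at `p = 3 ∥ N` (door
`JET.bsdp_of_jetRowA3_tamX_min`)); `N = 335244 = 2^2·3·7·13·307`, nonsplit `I4` at `3`, `r_an = 1`, `#E(ℚ)_tors = 1`, `∏c = 24`, `#Ш_an = 1`,
Cremona galrep: no code at this prime (`ρ̄_{E,3}` onto); `|Δ| = ∏` over `[(2, 8), (3, 4), (7, 2), (13, 2), (307, 1)]` (factored Kraus criterion,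
every disjunct decided). The ONE carrier: carrier `q = 2` ADDITIVE of type `IV*` (`c_q = 3`, `w = ord_3 c_q = 1`; IN THE KERNEL by the exact `TamX`
certificate `⟨2, 1, 3, 3, 0, 2, 8, 0⟩`); READING binder `hJ` = K1 `JetchevDivisibilityCarrierNe`; displayed index line `hv : ord_3 [E(K):ℤP] ≤ 1`.
Serre Prop-15 witnesses mod `3`: `(ℓ, #Ẽ(𝔽_ℓ))` = `(5, 4)` (`X² − aX + ℓ` root-free over `𝔽₃`), `(19, 15)` (`ℓ ≡ 1`, `a ≡ 2 (mod 3)`, `9 ∤ #Ẽ`).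
Kurihara lane note of record: «multiplicative p, r=1, irr (Castella 2018 Thm A withdrawn for p||N)». State of record (referee A ROUND 983,
`scratchA_A_state_after_x4gh_add3_onA2R977_fold.pkl`): class `residue`, 1 open cell(s), register empty. Other engine-1 fields tried (`D`: `m`
(`ord_3 m`)): `-1511`: `m = 144` (`ord = 2`); `-2063`: `m = 48` (`ord = 1`); `-2183`: `m = 48` (`ord = 1`); `-2903`: `m = 48` (`ord = 1`); `-3407`:
`m = 48` (`ord = 1`); `-3743`: `m = 48` (`ord = 1`); `-4079`: `m = 48` (`ord = 1`); `-4343`: `m = 96` (`ord = 1`); `-4679`: `m = 96` (`ord = 1`);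
`-4703`: `m = 96` (`ord = 1`). THIS UNIT'S DATUM (displayed, NOT re-computed here): DEEP FIELD `K = ℚ(√-1847)` (`1847` = prime): **`m = [E(K):ℤy_K]
= 48`, `ord_3 m = 1`** (`ρ = m²/4`, `L'(E,1) = 9.7773834765`, `L(E^D,1) = 0.7704744444`, `ĥ(P) = 0.6254554277`; Cremona's generator) — engine 1
j293234 = engine 2 j294330: `m = 48` EQUAL (AGREE v_p(m)=1, dev ≤ 6.2e-14); twist `E^D` (j294332): `N = 1143654398796`, `#tors·∏c·#Ш_an = 1·48·1`,
`ord_3 #Ш_an(E^D) = 0`, `ord_3 ∏c(E^D) = 1` (BSD-consistent). CONDITIONAL on every binder; per cell; nothing booked by this file.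
[cite: Jetchev2008, Thm. 1.4 and Cor. 1.5 (p. 812)] [cite: McCallumLMS1991, Cor. 5.6] [cite: Serre1972, §2.4 Prop. 15, §2.8 Prop. 19] [cite: Cremona2006, Table 1 (label 335244h1)] -/
theorem bsdpJD_335244h1_3
    (hJ : JetchevDivisibilityCarrierNe)
    (hMcU : McCallum1991_padicValNat_card_sha_primary_add_le_of_globalDivisibility)
    (hGZK : rank_eq_analyticRank_of_analyticRank_le_one)
    (hKo : ∀ (N : ℕ) [NeZero N] (W : WeierstrassCurve ℚ) (K : Type) [Field K] [NumberField K], kolyvagin N W K)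
    (hrec : ∀ (N : ℕ) [NeZero N] (W : WeierstrassCurve ℚ) (K : Type) [Field K] [NumberField K],
      heegnerPointOfConductor_one_galoisConj N W K)
    (hD36 : ∀ (N : ℕ) [NeZero N] (W : WeierstrassCurve ℚ) (K : Type) [Field K] [NumberField K],
      phi_heegnerTau_mem_singularModuliField N W K)
    (hlev : ∀ {N : ℕ} [NeZero N], IsNewformOf.level_eq_conductorNorm (N := N))
    (W : WeierstrassCurve ℚ) (hW : W = ⟨0, -1, 0, 923, -2687⟩)
    {N : ℕ} [NeZero N] {K : Type} [Field K] [NumberField K] (hK : IsImaginaryQuadratic K)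
    (hD3 : NumberField.discr K ≠ -3) (hD4 : NumberField.discr K ≠ -4)
    (hH : SatisfiesHeegnerHypothesis N K) {P : (W.baseChange K).toAffine.Point}
    (hP : IsHeegnerPoint N W K P) (hnt : ¬ IsOfFinAddOrder P) (hqN : 2 ∣ N)
    (hv : padicValNat 3 (AddSubgroup.zmultiples P).index ≤ 1)
    (hr : W.analyticRank ≤ 1) {s : ℚ} (hs : shaAn W = (s : ℂ)) (hvs : padicValRat 3 s = 0) : BSDp W 3 :=
  bsdp_of_jetRowA3_tamX_min 0 (-1) 0 923 (-2687)
    (Supersingular.isGloballyMinimal_of_krausCriterion₃_factored 0 (-1) 0 923 (-2687) [(2, 8), (3, 4), (7, 2), (13, 2), (307, 1)] (by decide +kernel)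
      (by intro t ht; fin_cases ht <;> norm_num) (by decide +kernel))
    (by decide +kernel) (by decide +kernel)
    5 19 (by norm_num) (by norm_num) (by decide) (by decide) (by decide) (by decide) (by decide +kernel) (by decide +kernel)
    (n₁ := 4) (n₂ := 15) (by decide +kernel) (by decide +kernel) (by decide) (by decide) (by decide) (by decide)
    2 (by norm_num) ⟨2, 1, 3, 3, 0, 2, 8, 0⟩ rfl (by decide +kernel) (w := 1) (by decide +kernel) (by decide)
    hJ hMcU hGZK hKo hrec hD36 hlev W hW hK hD3 hD4 hH hP hnt hqN hv hr hs hvs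

/-- **`BSD(E,3)` for `335580n1`** (cell `(335580n1, 3)`, class X11b, rank 1; JET grammar key `JETA:335580n1@3`, bucket A at `p = 3 ∥ N` (door
`JET.bsdp_of_jetRowA3_tamX_min`)); `N = 335580 = 2^2·3·5·7·17·47`, nonsplit `I2` at `3`, `r_an = 1`, `#E(ℚ)_tors = 2`, `∏c = 12`, `#Ш_an = 1`,
Cremona galrep: no code at this prime (`ρ̄_{E,3}` onto); `|Δ| = ∏` over `[(2, 4), (3, 2), (5, 1), (7, 1), (17, 2), (47, 1)]` (factored Kraus
criterion, every disjunct decided). The ONE carrier: carrier `q = 2` ADDITIVE of type `IV` (`c_q = 3`, `w = ord_3 c_q = 1`; IN THE KERNEL by the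
exact `TamX` certificate `⟨2, 1, 1, 1, 0, 1, 4, 0⟩`); READING binder `hJ` = K1 `JetchevDivisibilityCarrierNe`; displayed index line `hv : ord_3
[E(K):ℤP] ≤ 1`. Serre Prop-15 witnesses mod `3`: `(ℓ, #Ẽ(𝔽_ℓ))` = `(13, 20)` (`X² − aX + ℓ` root-free over `𝔽₃`), `(103, 96)` (`ℓ ≡ 1`, `a ≡ 2 (mod
3)`, `9 ∤ #Ẽ`). Kurihara lane note of record: «multiplicative p, r=1, irr (Castella 2018 Thm A withdrawn for p||N)». State of record (referee A
ROUND 983, `scratchA_A_state_after_x4gh_add3_onA2R977_fold.pkl`): class `residue`, 1 open cell(s), register empty. Other engine-1 fields tried (`D`: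
`m` (`ord_3 m`)): `-671`: `m = 36` (`ord = 2`); `-2831`: `m = 72` (`ord = 2`); `-3671`: `m = 24` (`ord = 1`); `-3911`: `m = 12` (`ord = 1`);
`-4679`: `m = 12` (`ord = 1`); `-4871`: `m = 24` (`ord = 1`); `-5351`: `m = 72` (`ord = 2`); `-5591`: `m = 24` (`ord = 1`). THIS UNIT'S DATUM
(displayed, NOT re-computed here): DEEP FIELD `K = ℚ(√-2231)` (`2231` = 23·97): **`m = [E(K):ℤy_K] = 48`, `ord_3 m = 1`** (`ρ = m²/4`, `L'(E,1) =
4.3824166197`, `L(E^D,1) = 7.9711122182`, `ĥ(P) = 1.4916932781`; Cremona's generator) — engine 1 j293239 = engine 2 j294065: `m = 48` EQUAL (AGREE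
v_p(m)=1, dev ≤ 1.8e-14); twist `E^D` (j294066): `N = 1670302804380`, `#tors·∏c·#Ш_an = 2·192·4`, `ord_3 #Ш_an(E^D) = 0`, `ord_3 ∏c(E^D) = 1`
(BSD-consistent). CONDITIONAL on every binder; per cell; nothing booked by this file.
[cite: Jetchev2008, Thm. 1.4 and Cor. 1.5 (p. 812)] [cite: McCallumLMS1991, Cor. 5.6] [cite: Serre1972, §2.4 Prop. 15, §2.8 Prop. 19] [cite: Cremona2006, Table 1 (label 335580n1)] -/
theorem bsdpJD_335580n1_3
    (hJ : JetchevDivisibilityCarrierNe)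
    (hMcU : McCallum1991_padicValNat_card_sha_primary_add_le_of_globalDivisibility)
    (hGZK : rank_eq_analyticRank_of_analyticRank_le_one)
    (hKo : ∀ (N : ℕ) [NeZero N] (W : WeierstrassCurve ℚ) (K : Type) [Field K] [NumberField K], kolyvagin N W K)
    (hrec : ∀ (N : ℕ) [NeZero N] (W : WeierstrassCurve ℚ) (K : Type) [Field K] [NumberField K],
      heegnerPointOfConductor_one_galoisConj N W K)
    (hD36 : ∀ (N : ℕ) [NeZero N] (W : WeierstrassCurve ℚ) (K : Type) [Field K] [NumberField K],
      phi_heegnerTau_mem_singularModuliField N W K)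
    (hlev : ∀ {N : ℕ} [NeZero N], IsNewformOf.level_eq_conductorNorm (N := N))
    (W : WeierstrassCurve ℚ) (hW : W = ⟨0, -1, 0, -565, -4970⟩)
    {N : ℕ} [NeZero N] {K : Type} [Field K] [NumberField K] (hK : IsImaginaryQuadratic K)
    (hD3 : NumberField.discr K ≠ -3) (hD4 : NumberField.discr K ≠ -4)
    (hH : SatisfiesHeegnerHypothesis N K) {P : (W.baseChange K).toAffine.Point}
    (hP : IsHeegnerPoint N W K P) (hnt : ¬ IsOfFinAddOrder P) (hqN : 2 ∣ N)
    (hv : padicValNat 3 (AddSubgroup.zmultiples P).index ≤ 1)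
    (hr : W.analyticRank ≤ 1) {s : ℚ} (hs : shaAn W = (s : ℂ)) (hvs : padicValRat 3 s = 0) : BSDp W 3 :=
  bsdp_of_jetRowA3_tamX_min 0 (-1) 0 (-565) (-4970)
    (Supersingular.isGloballyMinimal_of_krausCriterion₃_factored 0 (-1) 0 (-565) (-4970) [(2, 4), (3, 2), (5, 1), (7, 1), (17, 2), (47, 1)] (by decide +kernel)
      (by intro t ht; fin_cases ht <;> norm_num) (by decide +kernel))
    (by decide +kernel) (by decide +kernel)
    13 103 (by norm_num) (by norm_num) (by decide) (by decide) (by decide) (by decide) (by decide +kernel) (by decide +kernel)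
    (n₁ := 20) (n₂ := 96) (by decide +kernel) (by decide +kernel) (by decide) (by decide) (by decide) (by decide)
    2 (by norm_num) ⟨2, 1, 1, 1, 0, 1, 4, 0⟩ rfl (by decide +kernel) (w := 1) (by decide +kernel) (by decide)
    hJ hMcU hGZK hKo hrec hD36 hlev W hW hK hD3 hD4 hH hP hnt hqN hv hr hs hvs

/-- **`BSD(E,3)` for `338910y1`** (cell `(338910y1, 3)`, class X11b, rank 1; JET grammar key `JETB:338910y1@3`, bucket B at `p = 3 ∥ N`, carrier `3`
(door `JET.bsdp_of_jetRowB3_tam_min`)); `N = 338910 = 2·3·5·11·13·79`, split `I18` at `3`, `r_an = 1`, `#E(ℚ)_tors = 2`, `∏c = 288`, `#Ш_an = 1`,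
Cremona galrep: no code at this prime (`ρ̄_{E,3}` onto); `|Δ| = ∏` over `[(2, 44), (3, 18), (5, 2), (11, 2), (13, 2), (79, 1)]` (factored Kraus
criterion, every disjunct decided). The ONE carrier: carrier `q = 3` (split `I18`, `c_q = 18`, `w = ord_3 c_q = 2`; IN THE KERNEL by the `TamLocal`
certificate `⟨3, 1, 1, 0, 0, 0, 0, 18, 0, 0, 18⟩`); READING binder `hJ` = K3 `JetchevDivisibilityCarrierMult`; displayed index line `hv : ord_3
[E(K):ℤP] ≤ 2`. Serre Prop-15 witnesses mod `3`: `(ℓ, #Ẽ(𝔽_ℓ))` = `(7, 8)` (`X² − aX + ℓ` root-free over `𝔽₃`), `(31, 24)` (`ℓ ≡ 1`, `a ≡ 2 (mod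
3)`, `9 ∤ #Ẽ`). Kurihara lane note of record: «multiplicative p, r=1, irr (Castella 2018 Thm A withdrawn for p||N)». State of record (referee A
ROUND 983, `scratchA_A_state_after_x4gh_add3_onA2R977_fold.pkl`): class `residue`, 1 open cell(s), register empty. Other engine-1 fields tried (`D`:
`m` (`ord_3 m`)): `-1271`: `m = 864` (`ord = 3`); `-2591`: `m = 576` (`ord = 2`); `-3071`: `m = 288` (`ord = 2`); `-3431`: `m = 288` (`ord = 2`);
`-4319`: `m = 288` (`ord = 2`); `-4991`: `m = 576` (`ord = 2`); `-5639`: `m = 288` (`ord = 2`). THIS UNIT'S DATUM (displayed, NOT re-computed here):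
DEEP FIELD `K = ℚ(√-1559)` (`1559` = prime): **`m = [E(K):ℤy_K] = 288`, `ord_3 m = 2`** (`ρ = m²/4`, `L'(E,1) = 7.3735917337`, `L(E^D,1) =
0.3736794013`, `ĥ(P) = 7.5480986541`; Cremona's generator) — engine 1 j293228 = engine 2 j293889: `m = 288` EQUAL (AGREE v_p(m)=2, dev ≤ 2.4e-14);
twist `E^D` (j293892): `N = 823714315710`, `#tors·∏c·#Ш_an = 2·576·4`, `ord_3 #Ш_an(E^D) = 0`, `ord_3 ∏c(E^D) = 2` (BSD-consistent). CONDITIONAL on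
every binder; per cell; nothing booked by this file.
[cite: Jetchev2008, Thm. 1.4 and Cor. 1.5 (p. 812)] [cite: McCallumLMS1991, Cor. 5.6] [cite: Serre1972, §2.4 Prop. 15, §2.8 Prop. 19] [cite: Cremona2006, Table 1 (label 338910y1)] -/
theorem bsdpJD_338910y1_3
    (hJ : JetchevDivisibilityCarrierMult)
    (hMcU : McCallum1991_padicValNat_card_sha_primary_add_le_of_globalDivisibility)
    (hGZK : rank_eq_analyticRank_of_analyticRank_le_one)
    (hKo : ∀ (N : ℕ) [NeZero N] (W : WeierstrassCurve ℚ) (K : Type) [Field K] [NumberField K], kolyvagin N W K)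
    (hrec : ∀ (N : ℕ) [NeZero N] (W : WeierstrassCurve ℚ) (K : Type) [Field K] [NumberField K],
      heegnerPointOfConductor_one_galoisConj N W K)
    (hD36 : ∀ (N : ℕ) [NeZero N] (W : WeierstrassCurve ℚ) (K : Type) [Field K] [NumberField K],
      phi_heegnerTau_mem_singularModuliField N W K)
    (hlev : ∀ {N : ℕ} [NeZero N], IsNewformOf.level_eq_conductorNorm (N := N))
    (W : WeierstrassCurve ℚ) (hW : W = ⟨1, 0, 1, -362012899, -25381170097378⟩)
    {N : ℕ} [NeZero N] {K : Type} [Field K] [NumberField K] (hK : IsImaginaryQuadratic K)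
    (hD3 : NumberField.discr K ≠ -3) (hD4 : NumberField.discr K ≠ -4)
    (hH : SatisfiesHeegnerHypothesis N K) {P : (W.baseChange K).toAffine.Point}
    (hP : IsHeegnerPoint N W K P) (hnt : ¬ IsOfFinAddOrder P)
    (hv : padicValNat 3 (AddSubgroup.zmultiples P).index ≤ 2)
    (hr : W.analyticRank ≤ 1) {s : ℚ} (hs : shaAn W = (s : ℂ)) (hvs : padicValRat 3 s = 0) : BSDp W 3 :=
  bsdp_of_jetRowB3_tam_min 1 0 1 (-362012899) (-25381170097378)
    (Supersingular.isGloballyMinimal_of_krausCriterion₃_factored 1 0 1 (-362012899) (-25381170097378) [(2, 44), (3, 18), (5, 2), (11, 2), (13, 2), (79, 1)] (by decide +kernel)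
      (by intro t ht; fin_cases ht <;> norm_num) (by decide +kernel))
    (by decide +kernel) (by decide +kernel)
    7 31 (by norm_num) (by norm_num) (by decide) (by decide) (by decide) (by decide) (by decide +kernel) (by decide +kernel)
    (n₁ := 8) (n₂ := 24) (by decide +kernel) (by decide +kernel) (by decide) (by decide) (by decide) (by decide)
    ⟨3, 1, 1, 0, 0, 0, 0, 18, 0, 0, 18⟩ rfl (by decide +kernel) (c := 18) (by decide +kernel) (w := 2) (by decide +kernel)
    hJ hMcU hGZK hKo hrec hD36 hlev W hW hK hD3 hD4 hH hP hnt hv hr hs hvs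

end Summit.BirchSwinnertonDyer.Rank1Residual.X11b

end
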